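import Literature.Probability.RandomPlanarGeometry.HexParafermion
import Literature.Probability.RandomPlanarGeometry.HexSAW
import Literature.Probability.RandomPlanarGeometry.CurveSpace
import Literature.Probability.LatticeModels.TriangularLatticeProofs
import HarnessLib

/-!
# Crux `SAWDevelopingMap.ObservableToSLE` (stmt-CriticalPhenomena-10472), line `six-class-type-ladder`,
stub T2b `stub_carvedReduction` (= twin stub 5a4 of stmt-CriticalPhenomena-14005): piece (G1b),
LATTICE TRANSLATION COVARIANCE of the Duminil-Copin–Smirnov sums

Landing target:
`Summits/CriticalPhenomena/SAWScalingLimit/Theorems/SAWDevelopingMapObservableToSLETypeLadderCarvedReductionTranslation.lean`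
(`--supports stmt-CriticalPhenomena-10472`; registered sub-goal `stub_carvedReduction_translation`).

The moving-carving reduction pins one re-rooted gate of the `k`-th carved lattice domain at the
origin by a LATTICE TRANSLATION `w ↦ (x_k + w.1, w.2)` of the honeycomb lattice
(`HexVertex = Site 2 × Fin 2`), so that the fixed-domain identification T2a can be applied to one
fixed two-piece flat domain.  This file is the dictionary for that step on the side of the
measure-free Duminil-Copin–Smirnov sums over `HexMidEdgeSAW Λ a z` which T2a speaks:

* `hexGraph_adj_translate_iff`, `hexCenter_translate` — the translation is an automorphism of
  the honeycomb lattice acting on face centres by `z ↦ z + triEmbed x`;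
* `exists_translateSAW`, `exists_equiv_hexMidEdgeSAW_translate` — mid-edge self-avoiding
  walks of `Λ` from `a` to `z` ≃ those of the translated domain between the translated mid-edges,
  translating vertex lists;
* `sum_hexMidEdgeSAW_translate` — hence every DCS sum `Σ_γ G(γ.verts)` is transported;
* `mk_polyline_translate` — the rescaled polyline of a translated vertex list is the translate
  by `δ · triEmbed x` of the rescaled polyline, as a curve class (`CurveClass.map` of the
  translation);
* `stub_carvedReduction_translation` — the registered one-line packaging.

Sources: H. Duminil-Copin, S. Smirnov, Ann. of Math. 175 (2012) (arXiv:1007.0575) §1–2 (walks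
between mid-edges); translation invariance of the honeycomb lattice (folklore).
-/

noncomputable section

open scoped BigOperators Topology NNReal ENNReal Classical
open Filter Set MeasureTheory Metric
open Literature.Probability.LatticeModels (HexVertex hexGraph hexCenter triZeta triEmbed Site polyline
  polylineFrom hexGraph_adj_iff_sub triEmbed_add)
open Literature.Probability.RandomPlanarGeometry
open Literature.Probability.RandomPlanarGeometry.SAW

namespace Summit.CriticalPhenomena.SAWScalingLimit.Theorems.ObservableToSLE.TypeLadder

/-! ### The translation `w ↦ (x + w.1, w.2)` of the honeycomb lattice -/

/-- Translations preserve honeycomb adjacency. -/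
theorem hexGraph_adj_translate_iff (x : Site 2) (u w : HexVertex) :
    hexGraph.Adj (x + u.1, u.2) (x + w.1, w.2) ↔ hexGraph.Adj u w := by
  obtain ⟨a, k⟩ := u
  obtain ⟨b, l⟩ := w
  rw [hexGraph_adj_iff_sub, hexGraph_adj_iff_sub a b, add_sub_add_left_eq_sub]

/-- Face centres are translation covariant. -/
theorem hexCenter_translate (x : Site 2) (w : HexVertex) :
    hexCenter (x + w.1, w.2) = hexCenter w + triEmbed x := by
  obtain ⟨c, j⟩ := w
  simp only [hexCenter, triEmbed_add]
  ring

/-- Translating by `x` then by `-x` is the identity. -/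
theorem translate_neg_translate (x : Site 2) (w : HexVertex) :
    ((-x + (x + w.1, w.2).1, (x + w.1, w.2).2) : HexVertex) = w := by
  obtain ⟨c, j⟩ := w
  simp

/-- The translation is injective. -/
theorem translate_injective (x : Site 2) :
    Function.Injective fun w : HexVertex => ((x + w.1, w.2) : HexVertex) := by
  intro u w h
  have h' := congrArg (fun w : HexVertex => ((-x + w.1, w.2) : HexVertex)) h
  simpa using h'

/-- Translated lists: mapping by `x` then `-x` is the identity. -/
theorem map_translate_neg_translate (x : Site 2) (l : List HexVertex) :
    (l.map fun w : HexVertex => ((x + w.1, w.2) : HexVertex)).map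
        (fun w : HexVertex => ((-x + w.1, w.2) : HexVertex)) = l := by
  rw [List.map_map]
  conv_rhs => rw [← List.map_id l]
  refine List.map_congr_left fun w _ => ?_
  simp

/-- Mid-edges are transported. -/
theorem mem_sym2_map_translate_iff (x : Site 2) (e : Sym2 HexVertex) (w : HexVertex) :
    ((x + w.1, w.2) : HexVertex) ∈ e.map (fun w : HexVertex => ((x + w.1, w.2) : HexVertex)) ↔
      w ∈ e := by
  rw [Sym2.mem_map]
  constructor
  · rintro ⟨u, hu, h⟩
    rwa [← translate_injective x h]
  · exact fun h => ⟨w, h, rfl⟩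

/-- Translating a mid-edge by `x` then by `-x` is the identity. -/
theorem sym2_map_translate_neg_translate (x : Site 2) (e : Sym2 HexVertex) :
    (e.map fun w : HexVertex => ((x + w.1, w.2) : HexVertex)).map
        (fun w : HexVertex => ((-x + w.1, w.2) : HexVertex)) = e := by
  induction e using Sym2.ind with
  | h u w => simp [Sym2.map_mk]

/-- Translating a mid-edge by `-x` then by `x` is the identity. -/
theorem sym2_map_neg_translate_translate (x : Site 2) (e : Sym2 HexVertex) :
    (e.map fun w : HexVertex => ((-x + w.1, w.2) : HexVertex)).map
        (fun w : HexVertex => ((x + w.1, w.2) : HexVertex)) = e := by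
  induction e using Sym2.ind with
  | h u w => simp [Sym2.map_mk]

/-- Honeycomb edges are transported. -/
theorem sym2_map_translate_mem_edgeSet_iff (x : Site 2) (e : Sym2 HexVertex) :
    e.map (fun w : HexVertex => ((x + w.1, w.2) : HexVertex)) ∈ hexGraph.edgeSet ↔
      e ∈ hexGraph.edgeSet := by
  induction e using Sym2.ind with
  | h u w => simp only [Sym2.map_mk, SimpleGraph.mem_edgeSet, hexGraph_adj_translate_iff]

section Domain

variable (x : Site 2) {Λ Λₓ : Finset HexVertex}
  (hΛ : ∀ w : HexVertex, w ∈ Λₓ ↔ ((-x + w.1, w.2) : HexVertex) ∈ Λ)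

include hΛ

/-- Membership in the translated domain. -/
theorem translate_mem_iff (w : HexVertex) : ((x + w.1, w.2) : HexVertex) ∈ Λₓ ↔ w ∈ Λ := by
  rw [hΛ]
  simp

/-- Mid-edges of the domain are transported. -/
theorem sym2_map_translate_mem_hexDomainMidEdges_iff (e : Sym2 HexVertex) :
    e.map (fun w : HexVertex => ((x + w.1, w.2) : HexVertex)) ∈ hexDomainMidEdges Λₓ ↔
      e ∈ hexDomainMidEdges Λ := by
  simp only [hexDomainMidEdges, Set.mem_setOf_eq, sym2_map_translate_mem_edgeSet_iff]
  refine and_congr_right fun _ => ?_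
  constructor
  · rintro ⟨v, hv, hvΛ⟩
    obtain ⟨u, hu, rfl⟩ := Sym2.mem_map.1 hv
    exact ⟨u, hu, (translate_mem_iff x hΛ u).1 hvΛ⟩
  · rintro ⟨v, hv, hvΛ⟩
    exact ⟨(x + v.1, v.2), (mem_sym2_map_translate_iff x e v).2 hv, (translate_mem_iff x hΛ v).2 hvΛ⟩

/-- Boundary mid-edges of the domain are transported. -/
theorem sym2_map_translate_mem_hexDomainBoundary_iff (e : Sym2 HexVertex) :
    e.map (fun w : HexVertex => ((x + w.1, w.2) : HexVertex)) ∈ hexDomainBoundary Λₓ ↔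
      e ∈ hexDomainBoundary Λ := by
  simp only [hexDomainBoundary, Set.mem_setOf_eq, sym2_map_translate_mem_edgeSet_iff]
  refine and_congr_right fun _ => ?_
  constructor
  · rintro ⟨u, v, he, hv, hu⟩
    refine ⟨(-x + u.1, u.2), (-x + v.1, v.2), ?_, (hΛ v).1 hv, fun h => hu ((hΛ u).2 h)⟩
    have h2 := congrArg (Sym2.map fun w : HexVertex => ((-x + w.1, w.2) : HexVertex)) he
    rwa [sym2_map_translate_neg_translate, Sym2.map_mk] at h2
  · rintro ⟨u, v, rfl, hv, hu⟩
    refine ⟨(x + u.1, u.2), (x + v.1, v.2), by rw [Sym2.map_mk], (translate_mem_iff x hΛ v).2 hv,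
      fun h => hu ((translate_mem_iff x hΛ u).1 h)⟩

/-- **A mid-edge self-avoiding walk, translated**: there is a walk of the translated domain
between the translated mid-edges with the translated vertex list. -/
theorem exists_translateSAW {a z : Sym2 HexVertex} (γ : HexMidEdgeSAW Λ a z) :
    ∃ γ' : HexMidEdgeSAW Λₓ (a.map fun w : HexVertex => ((x + w.1, w.2) : HexVertex))
      (z.map fun w : HexVertex => ((x + w.1, w.2) : HexVertex)),
      γ'.verts = γ.verts.map fun w : HexVertex => ((x + w.1, w.2) : HexVertex) := by
  refine ⟨{ verts := γ.verts.map fun w : HexVertex => ((x + w.1, w.2) : HexVertex)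
            subset := ?_, nodup := (List.nodup_map_iff (translate_injective x)).2 γ.nodup
            isChain := List.isChain_map_of_isChain _
              (fun u w h => (hexGraph_adj_translate_iff x u w).2 h) γ.isChain
            head_mem := ?_, getLast_mem := ?_
            eq_of_nil := fun h => by rw [γ.eq_of_nil (List.map_eq_nil_iff.1 h)]
            edges_nodup := ?_
            fst_mem := (sym2_map_translate_mem_hexDomainMidEdges_iff x hΛ a).2 γ.fst_mem }, rfl⟩
  · intro v hv
    obtain ⟨w, hw, rfl⟩ := List.mem_map.1 hv
    exact (translate_mem_iff x hΛ w).2 (γ.subset w hw)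
  · intro v hv
    rw [List.head?_map] at hv
    obtain ⟨w, hw, rfl⟩ := Option.map_eq_some_iff.1 hv
    exact (mem_sym2_map_translate_iff x a w).2 (γ.head_mem w hw)
  · intro v hv
    rw [List.getLast?_map] at hv
    obtain ⟨w, hw, rfl⟩ := Option.map_eq_some_iff.1 hv
    exact (mem_sym2_map_translate_iff x z w).2 (γ.getLast_mem w hw)
  · intro hne
    have hne' : γ.verts ≠ [] := fun h => hne (by rw [h, List.map_nil])
    have h := γ.edges_nodup hne'
    have hmap : (a.map (fun w : HexVertex => ((x + w.1, w.2) : HexVertex)) ::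
        List.zipWith (fun u w => s(u, w)) (γ.verts.map fun w : HexVertex => ((x + w.1, w.2) : HexVertex))
          ((γ.verts.map fun w : HexVertex => ((x + w.1, w.2) : HexVertex)).tail) ++
        [z.map fun w : HexVertex => ((x + w.1, w.2) : HexVertex)]) =
        (a :: List.zipWith (fun u w => s(u, w)) γ.verts γ.verts.tail ++ [z]).map
          (Sym2.map fun w : HexVertex => ((x + w.1, w.2) : HexVertex)) := by
      rw [List.map_append, List.map_cons, List.map_singleton, ← List.map_tail, List.zipWith_map]
      simp only [List.cons_append, List.cons.injEq, true_and, List.append_cancel_right_eq]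
      rw [List.map_zipWith]
      rfl
    rw [hmap]
    exact (List.nodup_map_iff (Sym2.map.injective (translate_injective x))).2 h

end Domain

/-- **THE TRANSLATION BIJECTION of mid-edge self-avoiding walks**, translating vertex lists. -/
theorem exists_equiv_hexMidEdgeSAW_translate (x : Site 2) {Λ Λₓ : Finset HexVertex}
    (hΛ : ∀ w : HexVertex, w ∈ Λₓ ↔ ((-x + w.1, w.2) : HexVertex) ∈ Λ) (a z : Sym2 HexVertex) :
    ∃ e : HexMidEdgeSAW Λ a z ≃
        HexMidEdgeSAW Λₓ (a.map fun w : HexVertex => ((x + w.1, w.2) : HexVertex))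
          (z.map fun w : HexVertex => ((x + w.1, w.2) : HexVertex)),
      ∀ γ, (e γ).verts = γ.verts.map fun w : HexVertex => ((x + w.1, w.2) : HexVertex) := by
  -- the inverse data
  have hΛ' : ∀ w : HexVertex, w ∈ Λ ↔ ((- -x + w.1, w.2) : HexVertex) ∈ Λₓ := fun w => by
    rw [hΛ]; simp
  have ha : (a.map fun w : HexVertex => ((x + w.1, w.2) : HexVertex)).map
      (fun w : HexVertex => ((-x + w.1, w.2) : HexVertex)) = a := sym2_map_translate_neg_translate x a
  have hz : (z.map fun w : HexVertex => ((x + w.1, w.2) : HexVertex)).map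
      (fun w : HexVertex => ((-x + w.1, w.2) : HexVertex)) = z := sym2_map_translate_neg_translate x z
  have key : ∀ (a' z' : Sym2 HexVertex) (ha' : a' = a) (hz' : z' = z) (γ' : HexMidEdgeSAW Λ a' z'),
      (ha' ▸ hz' ▸ γ').verts = γ'.verts := by
    rintro _ _ rfl rfl γ'; rfl
  refine ⟨{ toFun := fun γ => Classical.choose (exists_translateSAW x hΛ γ)
            invFun := fun γ => ha ▸ hz ▸ Classical.choose (exists_translateSAW (-x) hΛ' γ)
            left_inv := fun γ => ?_
            right_inv := fun γ => ?_ }, fun γ => Classical.choose_spec (exists_translateSAW x hΛ γ)⟩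
  · apply HexMidEdgeSAW.ext
    rw [key _ _ ha hz, Classical.choose_spec (exists_translateSAW (-x) hΛ' _),
      Classical.choose_spec (exists_translateSAW x hΛ γ), map_translate_neg_translate]
  · apply HexMidEdgeSAW.ext
    change (Classical.choose (exists_translateSAW x hΛ _)).verts = γ.verts
    rw [Classical.choose_spec (exists_translateSAW x hΛ _), key _ _ ha hz,
      Classical.choose_spec (exists_translateSAW (-x) hΛ' γ)]
    have := map_translate_neg_translate (-x) γ.verts
    simpa using this

/-- **DCS sums are transported by lattice translations.** -/
theorem sum_hexMidEdgeSAW_translate (x : Site 2) {Λ Λₓ : Finset HexVertex}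
    (hΛ : ∀ w : HexVertex, w ∈ Λₓ ↔ ((-x + w.1, w.2) : HexVertex) ∈ Λ) (a z : Sym2 HexVertex)
    (G : List HexVertex → ℝ) :
    ∑ γ : HexMidEdgeSAW Λₓ (a.map fun w : HexVertex => ((x + w.1, w.2) : HexVertex))
        (z.map fun w : HexVertex => ((x + w.1, w.2) : HexVertex)), G γ.verts =
      ∑ γ : HexMidEdgeSAW Λ a z, G (γ.verts.map fun w : HexVertex => ((x + w.1, w.2) : HexVertex)) := by
  obtain ⟨e, he⟩ := exists_equiv_hexMidEdgeSAW_translate x hΛ a z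
  exact (Fintype.sum_equiv e _ _ fun γ => by rw [he]).symm

/-! ### Translated polylines -/

/-- A translation commutes with `polylineFrom`, pointwise in time. -/
theorem add_polylineFrom_apply (τ p : ℂ) (l : List ℂ) (t : unitInterval) :
    (polylineFrom p l).2 t + τ = (polylineFrom (p + τ) (l.map (· + τ))).2 t := by
  induction l generalizing p t with
  | nil => rfl
  | cons y l ih =>
    change ((Path.segment p y).trans (polylineFrom y l).2) t + τ =
      ((Path.segment (p + τ) (y + τ)).trans (polylineFrom (y + τ) (l.map (· + τ))).2) t
    rw [Path.trans_apply, Path.trans_apply]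
    split_ifs with h
    · simp only [Path.segment_apply, AffineMap.lineMap_apply_module, Complex.real_smul]
      push_cast
      ring
    · exact ih y _

/-- **The rescaled polyline of a translated vertex list is the translated rescaled polyline**, as
a curve class: `CurveClass.map (· + δ triEmbed x)`. (Nonempty lists: the empty polyline is the
junk constant `0`.) -/
theorem mk_polyline_translate (x : Site 2) (δ : ℝ) {l : List HexVertex} (hl : l ≠ []) :
    CurveClass.mk ⟨polyline ((l.map fun w : HexVertex => ((x + w.1, w.2) : HexVertex)).map
        fun w => (δ : ℂ) * hexCenter w)⟩ =
      CurveClass.map ⟨fun z : ℂ => z + (δ : ℂ) * triEmbed x, by fun_prop⟩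
        (CurveClass.mk ⟨polyline (l.map fun w => (δ : ℂ) * hexCenter w)⟩) := by
  obtain ⟨w, l, rfl⟩ := List.exists_cons_of_ne_nil hl
  rw [CurveClass.map_mk]
  congr 1
  apply Curve.ext
  ext t
  simp only [List.map_cons, List.map_map]
  show (polylineFrom ((δ : ℂ) * hexCenter ((x + w.1, w.2) : HexVertex))
      (l.map ((fun w => (δ : ℂ) * hexCenter w) ∘ fun w : HexVertex => ((x + w.1, w.2) : HexVertex)))).2 t =
    (polylineFrom ((δ : ℂ) * hexCenter w) (l.map fun w => (δ : ℂ) * hexCenter w)).2 t +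
      (δ : ℂ) * triEmbed x
  have hpt : (δ : ℂ) * hexCenter ((x + w.1, w.2) : HexVertex) =
      (δ : ℂ) * hexCenter w + (δ : ℂ) * triEmbed x := by
    rw [hexCenter_translate, mul_add]
  have hl' : l.map ((fun w => (δ : ℂ) * hexCenter w) ∘ fun w : HexVertex => ((x + w.1, w.2) : HexVertex)) =
      (l.map fun w => (δ : ℂ) * hexCenter w).map (· + (δ : ℂ) * triEmbed x) := by
    rw [List.map_map]
    refine List.map_congr_left fun u _ => ?_
    simp only [Function.comp_apply, hexCenter_translate, mul_add]
  rw [hpt, hl', ← add_polylineFrom_apply]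

/-- **Registered sub-goal `stub_carvedReduction_translation`** (crux item stmt-CriticalPhenomena-10472,
stub T2b `stub_carvedReduction`, piece (G1b) LATTICE TRANSLATION COVARIANCE): the Duminil-Copin–Smirnov
sums of a translated vertex domain between translated mid-edges are the sums of the original
domain over translated vertex lists, and rescaled polylines of translated lists are translated
rescaled polylines. -/
theorem stub_carvedReduction_translation :
    ∀ (x : Site 2) (Λ Λₓ : Finset HexVertex) (a z : Sym2 HexVertex),
      (∀ w : HexVertex, w ∈ Λₓ ↔ ((-x + w.1, w.2) : HexVertex) ∈ Λ) →
      (∀ G : List HexVertex → ℝ,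
        ∑ γ : HexMidEdgeSAW Λₓ (a.map fun w : HexVertex => ((x + w.1, w.2) : HexVertex))
            (z.map fun w : HexVertex => ((x + w.1, w.2) : HexVertex)), G γ.verts =
          ∑ γ : HexMidEdgeSAW Λ a z,
            G (γ.verts.map fun w : HexVertex => ((x + w.1, w.2) : HexVertex))) ∧
      (∀ (δ : ℝ) (l : List HexVertex), l ≠ [] →
        CurveClass.mk ⟨polyline ((l.map fun w : HexVertex => ((x + w.1, w.2) : HexVertex)).map
            fun w => (δ : ℂ) * hexCenter w)⟩ =
          CurveClass.map ⟨fun z : ℂ => z + (δ : ℂ) * Literature.Probability.LatticeModels.triEmbed x, by fun_prop⟩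
            (CurveClass.mk ⟨polyline (l.map fun w => (δ : ℂ) * hexCenter w)⟩)) := by
  intro x Λ Λₓ a z hΛ
  exact ⟨fun G => sum_hexMidEdgeSAW_translate x hΛ a z G, fun δ l hl => mk_polyline_translate x δ hl⟩

end Summit.CriticalPhenomena.SAWScalingLimit.Theorems.ObservableToSLE.TypeLadder

end
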